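import Mathlib
import HarnessLib
import Summits.ResolutionOfSingularities.ResolutionOfSingularities.Theorems.WildQuotientsWildQuotientResolutionKSGoingDownOfStep

/-!
# Kollár–Szabó going down from a LOCAL blow-up step: the induction runs on local schemes
# (crux `WildQuotients.WildQuotientResolution`, stub `stub_phaseZeroHighDim`)

Crux stmt-ResolutionOfSingularities-15640 (`WildQuotientResolution`), registered stub `stub_phaseZeroHighDim`;
programme: discharge `Literature.AlgebraicGeometry.GroupActions.KollarSzaboGoingDown` (hand 8-g0, (K1)–(K5)).

✓`goingDown_of_step` / ✓`kollarSzaboGoingDown_of_step` (p828107/p828172) carry the finite-type / closed-point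
hypotheses of the named fact through the induction, which forces the blow-up step to produce a FINITE-TYPE
exceptional divisor `E` — i.e. a global (or at least chart-level) blow-up, whose `H`-stability needs an exact
eigen-parameter. But the induction itself never uses finite type: ✓`exists_stable_equivariant_extension`
needs `X` INTEGRAL only, and the eigenline (✓`AbelianEigenlineStalk`) needs only an algebraically closed
RESIDUE FIELD at the fixed point. This file re-runs the induction with exactly these hypotheses:

> `P' n`: `X` integral over `K` with an `H`-action over `K` (`H` finite abelian), a point `x` with
> `𝒪_{X,x}` regular of dimension `≤ n`, residue field `κ(𝒪_{X,x})` algebraically closed and `H ≤ I_x`; a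
> proper `Y/K` with an `H`-action and an equivariant `K`-morphism `φ : W → Y` on an `H`-stable non-empty
> open `W` ⇒ `H ≤ I_y` for some `y ∈ Y`.

so that the step may be supplied by LOCAL schemes: `X̃ = Spec S₁` for the EQUIVARIANT QUADRATIC TRANSFORM
`S₁ = 𝒪_{X,x}[𝔪/t]_𝔫` (hand 8-g1, (K2): `H`-stable, residue-trivial, regular of dimension `n + 1`, same residue
field), `η = (t) ∈ Spec S₁` (a discrete valuation ring, ✓`valuationRing_localization_span_singleton`),
`E = Spec (S₁/(t))` (integral; its closed point `x₁` has the regular local ring `S₁/(t)` of dimension `n`,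
✓`isRegularLocalRing_quotient_span_singleton`, ✓`ringKrullDim_quotient_span_singleton_eq`, the same
algebraically closed residue field, and `H ≤ I_{x₁}` by ✓`mem_inertiaSubgroup_specMap_of_invariant`).
No projective space, no global blow-up, no finite-typeness of `E`.

* `goingDown_of_localStep` — `∀ n, P' n` from the LOCAL step `hstep` (binders as displayed in the statement).
* `kollarSzaboGoingDown_of_localStep` — the named fact from `hstep` and (K1): at a closed point of a scheme
  locally of finite type over an algebraically closed field the residue field of the local ring is
  algebraically closed (hypothesis `hK1`, Hilbert's Nullstellensatz; [S]).

Remaining for `KollarSzaboGoingDown_holds` (census): (K1) [S]; (K2) the equivariant quadratic transform (hand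
8-g1); (K4'') the `Spec` packaging of (K2) into `hstep` with ✓`KSGoingDownSpecTools` / ✓`KSGoingDownExceptionalPrime` [M].

[OURS · crux stmt-ResolutionOfSingularities-15640 · helper toward `stub_phaseZeroHighDim` (conditional discharge of a
named fact; NOT a proof of the stub); counted 0; AI-level work, weaker than expert review.]
[cite: ReichsteinYoussin2000, Appendix (Kollár–Szabó), Prop. A.2 and its proof]
-/

-- single-problem summit: the doubled namespace component `ResolutionOfSingularities` is forced
set_option linter.dupNamespace false

noncomputable section

open CategoryTheory CategoryTheory.Limits AlgebraicGeometry TopologicalSpace IsLocalRing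
open Literature.AlgebraicGeometry.Ramification Literature.AlgebraicGeometry.Resolution
open Literature.AlgebraicGeometry.Morphisms

namespace Summit.ResolutionOfSingularities.ResolutionOfSingularities.Theorems.WildQuotientResolution.KSGoingDown

/-- **Kollár–Szabó going down, rational-map form on integral `K`-schemes, from the LOCAL blow-up step.**
See the module docstring for `P' n` and for the intended (local, affine) witnesses of `hstep`.
[cite: ReichsteinYoussin2000, Appendix (Kollár–Szabó), proof of Prop. A.2] -/
theorem goingDown_of_localStep
    (hstep : ∀ (K : Type) [Field K] [IsAlgClosed K] (X : Scheme.{0}) (sX : X ⟶ Spec (.of K))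
      [IsIntegral X] (H : Type) [CommGroup H] [Finite H] (σ : H →* Aut X), (∀ h, (σ h).hom ≫ sX = sX) →
      ∀ (x : X), IsRegularLocalRing (X.presheaf.stalk x) →
      IsAlgClosed (ResidueField (X.presheaf.stalk x)) →
      (∀ h, h ∈ inertiaSubgroup σ x) → ∀ n : ℕ, ringKrullDim (X.presheaf.stalk x) = (n + 1 : ℕ) →
      ∃ (X' : Scheme.{0}) (_ : IsIntegral X') (σ' : H →* Aut X') (b : X' ⟶ X) (_ : IsDominant b)
        (_ : ∀ h, (σ' h).hom ≫ b = b ≫ (σ h).hom) (η : X') (_ : ValuationRing (X'.presheaf.stalk η))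
        (E : Scheme.{0}) (_ : IsIntegral E) (σE : H →* Aut E) (i : E ⟶ X')
        (_ : ∀ h, (σE h).hom ≫ i = i ≫ (σ' h).hom) (_ : η ∈ Set.range i.base) (x₁ : E),
        IsRegularLocalRing (E.presheaf.stalk x₁) ∧ IsAlgClosed (ResidueField (E.presheaf.stalk x₁)) ∧
        (∀ h, h ∈ inertiaSubgroup σE x₁) ∧ ringKrullDim (E.presheaf.stalk x₁) = n) :
    ∀ (n : ℕ) (K : Type) [Field K] [IsAlgClosed K] (X : Scheme.{0}) (sX : X ⟶ Spec (.of K))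
      [IsIntegral X] (H : Type) [CommGroup H] [Finite H] (σ : H →* Aut X) (_ : ∀ h, (σ h).hom ≫ sX = sX)
      (x : X) (_ : IsRegularLocalRing (X.presheaf.stalk x))
      (_ : IsAlgClosed (ResidueField (X.presheaf.stalk x)))
      (_ : ∀ h, h ∈ inertiaSubgroup σ x) (_ : ringKrullDim (X.presheaf.stalk x) ≤ n)
      (Y : Scheme.{0}) (sY : Y ⟶ Spec (.of K)) [IsProper sY] (τ : H →* Aut Y)
      (W : X.Opens) (_ : (W : Set X).Nonempty) (hWst : ∀ h, (σ h).hom ⁻¹ᵁ W = W)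
      (φ : (W : Scheme.{0}) ⟶ Y) (_ : φ ≫ sY = W.ι ≫ sX)
      (_ : ∀ h, (σ h).hom.resLE W W (hWst h).ge ≫ φ = φ ≫ (τ h).hom),
      ∃ y : Y, ∀ h, h ∈ inertiaSubgroup τ y := by
  intro n
  induction n with
  | zero =>
    intro K _ _ X sX _ H _ _ σ hσ x hreg hκ hfix hdim Y sY _ τ W hWne hWst φ hφ hφeq
    haveI := hreg
    haveI : Y.IsSeparated := by
      constructor
      rw [show terminal.from Y = sY ≫ terminal.from _ from terminal.hom_ext _ _]
      infer_instance
    exact goingDown_of_valuationRing X sX σ x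
      (valuationRing_of_isRegularLocalRing_of_ringKrullDim_le_zero _ (by exact_mod_cast hdim))
      hfix Y sY τ W hWne hWst φ hφ hφeq
  | succ n ih =>
    intro K _ _ X sX _ H _ _ σ hσ x hreg hκ hfix hdim Y sY _ τ W hWne hWst φ hφ hφeq
    haveI := hreg
    obtain ⟨m, hm⟩ := Literature.AlgebraicGeometry.Resolution.ringKrullDim_eq_nat (X.presheaf.stalk x)
    by_cases hmn : m ≤ n
    · exact ih K X sX H σ hσ x hreg hκ hfix (by rw [hm]; exact_mod_cast hmn) Y sY τ W hWne hWst φ hφ hφeq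
    have hmeq : m = n + 1 := by
      have h1 : (m : WithBot ℕ∞) ≤ (n + 1 : ℕ) := by rw [← hm]; exact_mod_cast hdim
      have h2 : m ≤ n + 1 := by exact_mod_cast h1
      omega
    rw [hmeq] at hm
    obtain ⟨X', hX', σ', b, hbdom, hb, η, hη, E, hE, σE, i, hi, ⟨e₀, he₀⟩, x₁, hx₁reg, hx₁κ, hx₁fix,
      hx₁dim⟩ := hstep K X sX H σ hσ x hreg hκ hfix n hm
    haveI : Y.IsSeparated := by
      constructor
      rw [show terminal.from Y = sY ≫ terminal.from _ from terminal.hom_ext _ _]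
      infer_instance
    -- pull `φ` back along `b`
    let W' : X'.Opens := b ⁻¹ᵁ W
    have hW'ne : (W' : Set X').Nonempty := by
      obtain ⟨w, hw⟩ := hWne
      obtain ⟨z, hz⟩ := hbdom.denseRange.mem_nhds (W.2.mem_nhds hw)
      exact ⟨z, hz⟩
    have hW'st : ∀ h, (σ' h).hom ⁻¹ᵁ W' = W' := preimage_preimage_eq_of_comm σ σ' b hb hWst
    let φ' : (W' : Scheme.{0}) ⟶ Y := b.resLE W W' le_rfl ≫ φ
    have hφ' : φ' ≫ sY = W'.ι ≫ (b ≫ sX) := by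
      change (b.resLE W W' le_rfl ≫ φ) ≫ sY = _
      rw [Category.assoc, hφ, Scheme.Hom.resLE_comp_ι_assoc]
    have hφ'eq : ∀ h, (σ' h).hom.resLE W' W' (hW'st h).ge ≫ φ' = φ' ≫ (τ h).hom :=
      resLE_comp_equivariant σ τ σ' b hb hWst φ hφeq
    let ψ' : X'.PartialMap Y := ⟨W', W'.2.dense hW'ne, φ'⟩
    -- extend equivariantly across the valuation-ring point `η`
    obtain ⟨D, hD, -, Φ, hηD, hΦK, -, hΦeq⟩ :=
      exists_stable_equivariant_extension (b ≫ sX) sY σ' τ ψ' hφ' hW'st hφ'eq hη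
    -- restrict to `E` along `i`
    let WE : E.Opens := i ⁻¹ᵁ D
    have hWEne : (WE : Set E).Nonempty := ⟨e₀, show i.base e₀ ∈ D by rw [he₀]; exact hηD⟩
    have hWEst : ∀ h, (σE h).hom ⁻¹ᵁ WE = WE := preimage_preimage_eq_of_comm σ' σE i hi hD
    let φE : (WE : Scheme.{0}) ⟶ Y := i.resLE D WE le_rfl ≫ Φ
    have hφE : φE ≫ sY = WE.ι ≫ (i ≫ b ≫ sX) := by
      change (i.resLE D WE le_rfl ≫ Φ) ≫ sY = _
      rw [Category.assoc, hΦK, Scheme.Hom.resLE_comp_ι_assoc]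
    have hφEeq : ∀ h, (σE h).hom.resLE WE WE (hWEst h).ge ≫ φE = φE ≫ (τ h).hom :=
      resLE_comp_equivariant σ' τ σE i hi hD Φ hΦeq
    have hσE : ∀ h, (σE h).hom ≫ (i ≫ b ≫ sX) = i ≫ b ≫ sX := fun h => by
      rw [← Category.assoc, hi, Category.assoc, reassoc_of% (hb h), hσ]
    haveI := hE
    exact ih K E (i ≫ b ≫ sX) H σE hσE x₁ hx₁reg hx₁κ hx₁fix hx₁dim.le Y sY τ WE hWEne hWEst φE hφE
      hφEeq

/-- **Kollár–Szabó «going down» (the named fact, verbatim) from the LOCAL blow-up step and (K1).**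
`hK1`: at a closed point `x` of a scheme locally of finite type over an algebraically closed field `K`
the residue field `κ(𝒪_{X,x})` is algebraically closed (it is a finite extension of `K`; Nullstellensatz).
`hstep`: the local step of `goingDown_of_localStep` (equivariant quadratic transform, (K2)).
[cite: ReichsteinYoussin2000, Appendix (Kollár–Szabó), Prop. A.2] -/
theorem kollarSzaboGoingDown_of_localStep
    (hK1 : ∀ (K : Type) [Field K] [IsAlgClosed K] (X : Scheme.{0}) (sX : X ⟶ Spec (.of K))
      [LocallyOfFiniteType sX] (x : X), IsClosed ({x} : Set X) →
      IsAlgClosed (ResidueField (X.presheaf.stalk x)))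
    (hstep : ∀ (K : Type) [Field K] [IsAlgClosed K] (X : Scheme.{0}) (sX : X ⟶ Spec (.of K))
      [IsIntegral X] (H : Type) [CommGroup H] [Finite H] (σ : H →* Aut X), (∀ h, (σ h).hom ≫ sX = sX) →
      ∀ (x : X), IsRegularLocalRing (X.presheaf.stalk x) →
      IsAlgClosed (ResidueField (X.presheaf.stalk x)) →
      (∀ h, h ∈ inertiaSubgroup σ x) → ∀ n : ℕ, ringKrullDim (X.presheaf.stalk x) = (n + 1 : ℕ) →
      ∃ (X' : Scheme.{0}) (_ : IsIntegral X') (σ' : H →* Aut X') (b : X' ⟶ X) (_ : IsDominant b)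
        (_ : ∀ h, (σ' h).hom ≫ b = b ≫ (σ h).hom) (η : X') (_ : ValuationRing (X'.presheaf.stalk η))
        (E : Scheme.{0}) (_ : IsIntegral E) (σE : H →* Aut E) (i : E ⟶ X')
        (_ : ∀ h, (σE h).hom ≫ i = i ≫ (σ' h).hom) (_ : η ∈ Set.range i.base) (x₁ : E),
        IsRegularLocalRing (E.presheaf.stalk x₁) ∧ IsAlgClosed (ResidueField (E.presheaf.stalk x₁)) ∧
        (∀ h, h ∈ inertiaSubgroup σE x₁) ∧ ringKrullDim (E.presheaf.stalk x₁) = n) :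
    Literature.AlgebraicGeometry.GroupActions.KollarSzaboGoingDown := by
  intro K _ _ X Y sX _ _ _ _ _ π _ hbir H _ _ σ τ hσ hτ x hxcl hreg hfix
  obtain ⟨U, hUd, -, hUiso⟩ := hbir
  let W : X.Opens := ⟨⋂ h : H, (((σ h).hom ⁻¹ᵁ U : X.Opens) : Set X),
    isOpen_iInter_of_finite fun h => ((σ h).hom ⁻¹ᵁ U).2⟩
  have hWst : ∀ g, (σ g).hom ⁻¹ᵁ W = W := preimage_iInter_stable σ U
  have hWU : W ≤ U := by
    intro z hz
    have h1 := Set.mem_iInter.mp hz 1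
    rwa [map_one] at h1
  have hWne : (W : Set X).Nonempty := ⟨genericPoint X, genericPoint_mem_iInter σ U hUd.nonempty⟩
  haveI : IsIso (π ∣_ W) := isIso_morphismRestrict_of_le π hWU
  let s : (W : Scheme.{0}) ⟶ Y := inv (π ∣_ W) ≫ (π ⁻¹ᵁ W).ι
  have hs : s ≫ (π ≫ sX) = W.ι ≫ sX := by
    rw [← Category.assoc, inv_morphismRestrict_comp π]
  have hseq : ∀ h, (σ h).hom.resLE W W (hWst h).ge ≫ s = s ≫ (τ h).hom :=
    inv_morphismRestrict_equivariant σ τ π hτ hWst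
  haveI := hreg
  obtain ⟨n, hn⟩ := Literature.AlgebraicGeometry.Resolution.ringKrullDim_eq_nat (X.presheaf.stalk x)
  exact goingDown_of_localStep hstep n K X sX H σ hσ x hreg (hK1 K X sX x hxcl) hfix hn.le Y (π ≫ sX) τ
    W hWne hWst s hs hseq

/-- **(K1): at a closed point of a scheme locally of finite type over an algebraically closed field,
the residue field of the local ring is algebraically closed** (Hilbert's Nullstellensatz; Mathlib
`residueFieldIsoBase : κ(x) ≅ K`). [folklore] -/
theorem isAlgClosed_residueField_stalk_of_isClosed (K : Type) [Field K] [IsAlgClosed K] (X : Scheme.{0})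
    (sX : X ⟶ Spec (.of K)) [LocallyOfFiniteType sX] (x : X) (hx : IsClosed ({x} : Set X)) :
    IsAlgClosed (ResidueField (X.presheaf.stalk x)) :=
  IsAlgClosed.of_ringEquiv K _ (residueFieldIsoBase sX x hx).commRingCatIsoToRingEquiv.symm

/-- **Kollár–Szabó «going down» (the named fact `KollarSzaboGoingDown`, verbatim) from the LOCAL blow-up
step alone** ((K1) discharged by `isAlgClosed_residueField_stalk_of_isClosed`). The hypothesis `hstep` is
the equivariant quadratic transform packaged as local schemes — see the module docstring.
[cite: ReichsteinYoussin2000, Appendix (Kollár–Szabó), Prop. A.2] -/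
theorem kollarSzaboGoingDown_of_localStep'
    (hstep : ∀ (K : Type) [Field K] [IsAlgClosed K] (X : Scheme.{0}) (sX : X ⟶ Spec (.of K))
      [IsIntegral X] (H : Type) [CommGroup H] [Finite H] (σ : H →* Aut X), (∀ h, (σ h).hom ≫ sX = sX) →
      ∀ (x : X), IsRegularLocalRing (X.presheaf.stalk x) →
      IsAlgClosed (ResidueField (X.presheaf.stalk x)) →
      (∀ h, h ∈ inertiaSubgroup σ x) → ∀ n : ℕ, ringKrullDim (X.presheaf.stalk x) = (n + 1 : ℕ) →
      ∃ (X' : Scheme.{0}) (_ : IsIntegral X') (σ' : H →* Aut X') (b : X' ⟶ X) (_ : IsDominant b)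
        (_ : ∀ h, (σ' h).hom ≫ b = b ≫ (σ h).hom) (η : X') (_ : ValuationRing (X'.presheaf.stalk η))
        (E : Scheme.{0}) (_ : IsIntegral E) (σE : H →* Aut E) (i : E ⟶ X')
        (_ : ∀ h, (σE h).hom ≫ i = i ≫ (σ' h).hom) (_ : η ∈ Set.range i.base) (x₁ : E),
        IsRegularLocalRing (E.presheaf.stalk x₁) ∧ IsAlgClosed (ResidueField (E.presheaf.stalk x₁)) ∧
        (∀ h, h ∈ inertiaSubgroup σE x₁) ∧ ringKrullDim (E.presheaf.stalk x₁) = n) :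
    Literature.AlgebraicGeometry.GroupActions.KollarSzaboGoingDown :=
  kollarSzaboGoingDown_of_localStep
    (fun K _ _ X sX _ x hx => isAlgClosed_residueField_stalk_of_isClosed K X sX x hx) hstep

/-- **Variant with `dim 𝒪_{E,x₁} ≤ n` in the step** (the induction only needs the inequality; Krull's
height theorem bounds the dimension of the quadratic transform by its number of generators, so providers
need not compute the dimension exactly). [cite: ReichsteinYoussin2000, Appendix, proof of Prop. A.2] -/
theorem goingDown_of_localStepLE
    (hstep : ∀ (K : Type) [Field K] [IsAlgClosed K] (X : Scheme.{0}) (sX : X ⟶ Spec (.of K))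
      [IsIntegral X] (H : Type) [CommGroup H] [Finite H] (σ : H →* Aut X), (∀ h, (σ h).hom ≫ sX = sX) →
      ∀ (x : X), IsRegularLocalRing (X.presheaf.stalk x) →
      IsAlgClosed (ResidueField (X.presheaf.stalk x)) →
      (∀ h, h ∈ inertiaSubgroup σ x) → ∀ n : ℕ, ringKrullDim (X.presheaf.stalk x) = (n + 1 : ℕ) →
      ∃ (X' : Scheme.{0}) (_ : IsIntegral X') (σ' : H →* Aut X') (b : X' ⟶ X) (_ : IsDominant b)
        (_ : ∀ h, (σ' h).hom ≫ b = b ≫ (σ h).hom) (η : X') (_ : ValuationRing (X'.presheaf.stalk η))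
        (E : Scheme.{0}) (_ : IsIntegral E) (σE : H →* Aut E) (i : E ⟶ X')
        (_ : ∀ h, (σE h).hom ≫ i = i ≫ (σ' h).hom) (_ : η ∈ Set.range i.base) (x₁ : E),
        IsRegularLocalRing (E.presheaf.stalk x₁) ∧ IsAlgClosed (ResidueField (E.presheaf.stalk x₁)) ∧
        (∀ h, h ∈ inertiaSubgroup σE x₁) ∧ ringKrullDim (E.presheaf.stalk x₁) ≤ n) :
    ∀ (n : ℕ) (K : Type) [Field K] [IsAlgClosed K] (X : Scheme.{0}) (sX : X ⟶ Spec (.of K))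
      [IsIntegral X] (H : Type) [CommGroup H] [Finite H] (σ : H →* Aut X) (_ : ∀ h, (σ h).hom ≫ sX = sX)
      (x : X) (_ : IsRegularLocalRing (X.presheaf.stalk x))
      (_ : IsAlgClosed (ResidueField (X.presheaf.stalk x)))
      (_ : ∀ h, h ∈ inertiaSubgroup σ x) (_ : ringKrullDim (X.presheaf.stalk x) ≤ n)
      (Y : Scheme.{0}) (sY : Y ⟶ Spec (.of K)) [IsProper sY] (τ : H →* Aut Y)
      (W : X.Opens) (_ : (W : Set X).Nonempty) (hWst : ∀ h, (σ h).hom ⁻¹ᵁ W = W)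
      (φ : (W : Scheme.{0}) ⟶ Y) (_ : φ ≫ sY = W.ι ≫ sX)
      (_ : ∀ h, (σ h).hom.resLE W W (hWst h).ge ≫ φ = φ ≫ (τ h).hom),
      ∃ y : Y, ∀ h, h ∈ inertiaSubgroup τ y := by
  intro n
  induction n with
  | zero =>
    intro K _ _ X sX _ H _ _ σ hσ x hreg hκ hfix hdim Y sY _ τ W hWne hWst φ hφ hφeq
    haveI := hreg
    haveI : Y.IsSeparated := by
      constructor
      rw [show terminal.from Y = sY ≫ terminal.from _ from terminal.hom_ext _ _]
      infer_instance
    exact goingDown_of_valuationRing X sX σ x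
      (valuationRing_of_isRegularLocalRing_of_ringKrullDim_le_zero _ (by exact_mod_cast hdim))
      hfix Y sY τ W hWne hWst φ hφ hφeq
  | succ n ih =>
    intro K _ _ X sX _ H _ _ σ hσ x hreg hκ hfix hdim Y sY _ τ W hWne hWst φ hφ hφeq
    haveI := hreg
    obtain ⟨m, hm⟩ := Literature.AlgebraicGeometry.Resolution.ringKrullDim_eq_nat (X.presheaf.stalk x)
    by_cases hmn : m ≤ n
    · exact ih K X sX H σ hσ x hreg hκ hfix (by rw [hm]; exact_mod_cast hmn) Y sY τ W hWne hWst φ hφ hφeq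
    have hmeq : m = n + 1 := by
      have h1 : (m : WithBot ℕ∞) ≤ (n + 1 : ℕ) := by rw [← hm]; exact_mod_cast hdim
      have h2 : m ≤ n + 1 := by exact_mod_cast h1
      omega
    rw [hmeq] at hm
    obtain ⟨X', hX', σ', b, hbdom, hb, η, hη, E, hE, σE, i, hi, ⟨e₀, he₀⟩, x₁, hx₁reg, hx₁κ, hx₁fix,
      hx₁dim⟩ := hstep K X sX H σ hσ x hreg hκ hfix n hm
    haveI : Y.IsSeparated := by
      constructor
      rw [show terminal.from Y = sY ≫ terminal.from _ from terminal.hom_ext _ _]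
      infer_instance
    -- pull `φ` back along `b`
    let W' : X'.Opens := b ⁻¹ᵁ W
    have hW'ne : (W' : Set X').Nonempty := by
      obtain ⟨w, hw⟩ := hWne
      obtain ⟨z, hz⟩ := hbdom.denseRange.mem_nhds (W.2.mem_nhds hw)
      exact ⟨z, hz⟩
    have hW'st : ∀ h, (σ' h).hom ⁻¹ᵁ W' = W' := preimage_preimage_eq_of_comm σ σ' b hb hWst
    let φ' : (W' : Scheme.{0}) ⟶ Y := b.resLE W W' le_rfl ≫ φ
    have hφ' : φ' ≫ sY = W'.ι ≫ (b ≫ sX) := by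
      change (b.resLE W W' le_rfl ≫ φ) ≫ sY = _
      rw [Category.assoc, hφ, Scheme.Hom.resLE_comp_ι_assoc]
    have hφ'eq : ∀ h, (σ' h).hom.resLE W' W' (hW'st h).ge ≫ φ' = φ' ≫ (τ h).hom :=
      resLE_comp_equivariant σ τ σ' b hb hWst φ hφeq
    let ψ' : X'.PartialMap Y := ⟨W', W'.2.dense hW'ne, φ'⟩
    -- extend equivariantly across the valuation-ring point `η`
    obtain ⟨D, hD, -, Φ, hηD, hΦK, -, hΦeq⟩ :=
      exists_stable_equivariant_extension (b ≫ sX) sY σ' τ ψ' hφ' hW'st hφ'eq hη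
    -- restrict to `E` along `i`
    let WE : E.Opens := i ⁻¹ᵁ D
    have hWEne : (WE : Set E).Nonempty := ⟨e₀, show i.base e₀ ∈ D by rw [he₀]; exact hηD⟩
    have hWEst : ∀ h, (σE h).hom ⁻¹ᵁ WE = WE := preimage_preimage_eq_of_comm σ' σE i hi hD
    let φE : (WE : Scheme.{0}) ⟶ Y := i.resLE D WE le_rfl ≫ Φ
    have hφE : φE ≫ sY = WE.ι ≫ (i ≫ b ≫ sX) := by
      change (i.resLE D WE le_rfl ≫ Φ) ≫ sY = _
      rw [Category.assoc, hΦK, Scheme.Hom.resLE_comp_ι_assoc]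
    have hφEeq : ∀ h, (σE h).hom.resLE WE WE (hWEst h).ge ≫ φE = φE ≫ (τ h).hom :=
      resLE_comp_equivariant σ' τ σE i hi hD Φ hΦeq
    have hσE : ∀ h, (σE h).hom ≫ (i ≫ b ≫ sX) = i ≫ b ≫ sX := fun h => by
      rw [← Category.assoc, hi, Category.assoc, reassoc_of% (hb h), hσ]
    haveI := hE
    exact ih K E (i ≫ b ≫ sX) H σE hσE x₁ hx₁reg hx₁κ hx₁fix hx₁dim Y sY τ WE hWEne hWEst φE hφE
      hφEeq

/-- **The named fact from the LOCAL step with `dim ≤ n`** ((K1) discharged). [cite: ReichsteinYoussin2000,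
Appendix (Kollár–Szabó), Prop. A.2] -/
theorem kollarSzaboGoingDown_of_localStepLE
    (hstep : ∀ (K : Type) [Field K] [IsAlgClosed K] (X : Scheme.{0}) (sX : X ⟶ Spec (.of K))
      [IsIntegral X] (H : Type) [CommGroup H] [Finite H] (σ : H →* Aut X), (∀ h, (σ h).hom ≫ sX = sX) →
      ∀ (x : X), IsRegularLocalRing (X.presheaf.stalk x) →
      IsAlgClosed (ResidueField (X.presheaf.stalk x)) →
      (∀ h, h ∈ inertiaSubgroup σ x) → ∀ n : ℕ, ringKrullDim (X.presheaf.stalk x) = (n + 1 : ℕ) →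
      ∃ (X' : Scheme.{0}) (_ : IsIntegral X') (σ' : H →* Aut X') (b : X' ⟶ X) (_ : IsDominant b)
        (_ : ∀ h, (σ' h).hom ≫ b = b ≫ (σ h).hom) (η : X') (_ : ValuationRing (X'.presheaf.stalk η))
        (E : Scheme.{0}) (_ : IsIntegral E) (σE : H →* Aut E) (i : E ⟶ X')
        (_ : ∀ h, (σE h).hom ≫ i = i ≫ (σ' h).hom) (_ : η ∈ Set.range i.base) (x₁ : E),
        IsRegularLocalRing (E.presheaf.stalk x₁) ∧ IsAlgClosed (ResidueField (E.presheaf.stalk x₁)) ∧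
        (∀ h, h ∈ inertiaSubgroup σE x₁) ∧ ringKrullDim (E.presheaf.stalk x₁) ≤ n) :
    Literature.AlgebraicGeometry.GroupActions.KollarSzaboGoingDown := by
  intro K _ _ X Y sX _ _ _ _ _ π _ hbir H _ _ σ τ hσ hτ x hxcl hreg hfix
  obtain ⟨U, hUd, -, hUiso⟩ := hbir
  let W : X.Opens := ⟨⋂ h : H, (((σ h).hom ⁻¹ᵁ U : X.Opens) : Set X),
    isOpen_iInter_of_finite fun h => ((σ h).hom ⁻¹ᵁ U).2⟩
  have hWst : ∀ g, (σ g).hom ⁻¹ᵁ W = W := preimage_iInter_stable σ U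
  have hWU : W ≤ U := by
    intro z hz
    have h1 := Set.mem_iInter.mp hz 1
    rwa [map_one] at h1
  have hWne : (W : Set X).Nonempty := ⟨genericPoint X, genericPoint_mem_iInter σ U hUd.nonempty⟩
  haveI : IsIso (π ∣_ W) := isIso_morphismRestrict_of_le π hWU
  let s : (W : Scheme.{0}) ⟶ Y := inv (π ∣_ W) ≫ (π ⁻¹ᵁ W).ι
  have hs : s ≫ (π ≫ sX) = W.ι ≫ sX := by
    rw [← Category.assoc, inv_morphismRestrict_comp π]
  have hseq : ∀ h, (σ h).hom.resLE W W (hWst h).ge ≫ s = s ≫ (τ h).hom :=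
    inv_morphismRestrict_equivariant σ τ π hτ hWst
  haveI := hreg
  obtain ⟨n, hn⟩ := Literature.AlgebraicGeometry.Resolution.ringKrullDim_eq_nat (X.presheaf.stalk x)
  exact goingDown_of_localStepLE hstep n K X sX H σ hσ x hreg
    (isAlgClosed_residueField_stalk_of_isClosed K X sX x hxcl) hfix hn.le Y (π ≫ sX) τ W hWne hWst s hs hseq

end Summit.ResolutionOfSingularities.ResolutionOfSingularities.Theorems.WildQuotientResolution.KSGoingDown

end
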